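/-
Origin: expansion seat `planner-pub-hodgecm-pv14-g5-0`, handover #5 2026-08-18T10:06:22Z (`HOME/pub-hodgecm-pv14-g5/lean/Pv14g5/WeilThetaModelHeisenberg.lean`, md5 b0f03d3f, 562 lines);
landed by the gen-7 packager in gate run 28 as `HodgeCM/Automorphic/WeilThetaModelHeisenberg.lean` (import ^import Pv14g5\.→import HodgeCM.Automorphic. ×1; import ^import Pv14g4\.→import HodgeCM.Automorphic. ×1).
-/
/-
Origin: HOME/pub-hodgecm-pv14-g5/lean/Pv14g5/WeilThetaModelHeisenberg.lean — session planner-pub-hodgecm-pv14-g5-0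
(unit pub-hodgecm-pv14-g5, DAG-node prover #14 gen 5).  Intended final place:
`HodgeCM/Automorphic/WeilThetaModelHeisenberg.lean` (namespace `HodgeCM.SchwartzWeil`).
PACKAGER: rewrite `import Pv14g4.WeilThetaModelSchrodinger` to `import HodgeCM.Automorphic.WeilThetaModelSchrodinger`
(pv14-g4 HANDOVER #2, t27) and `import Pv14g5.SchwartzModulation` to `import HodgeCM.Automorphic.SchwartzModulation`
(this seat's HANDOVER #4); Mathlib otherwise.  Asserts nothing (no `axiom`, no new constants).
-/
import Summits.HodgeConjecture.HodgeCM.Automorphic.WeilThetaModelSchrodinger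
import Summits.HodgeConjecture.HodgeCM.Automorphic.SchwartzModulation

/-!
# The Schrödinger–Heisenberg–lattice Weil theta model: the FULL Heisenberg group at the real place

pv14-g4's `schrodingerModel E L m` (t27) realises prl1-g4's `WeilThetaModel` record with the COMMUTATIVE group
`Multiplicative E × U(1)` — translations and central phases only; GAPS `pv14g4-K1` (a) records that the other half
of the Heisenberg group, the modulations, was missing.  With the modulation operators of `SchwartzModulation`
(this seat's #4) the present file builds the model over the genuine, NON-COMMUTATIVE Heisenberg group:

* `Heis V` — the polarised Heisenberg group `V × V × U(1)` of a finite-dimensional real inner product space,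
  `(a, b, u) · (a', b', u') = (a + a', b + b', u u' 𝐞(-⟪a, b'⟫))`, a topological group (`Group`,
  `IsTopologicalGroup` instances, KERNEL);
* `rep V m : Heis V →* (𝓢(V, ℂ) →L[ℂ] 𝓢(V, ℂ))` — the weight-`m` Schrödinger representation
  `ρ_m(a, b, u) = u^m • M_{m b} ∘ τ_a` (`rep_apply : ρ_m(a,b,u) Φ x = u^m 𝐞(m⟪b, x⟫) Φ(x - a)`); the homomorphism
  law `repCLM_mul` IS the Heisenberg commutation relation of #4; `continuous_repCLM_uncurry` : `(h, Φ) ↦ ρ_m(h) Φ`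
  jointly continuous on `Heis V × 𝓢(V, ℂ)`;
* `thetaH V L m Φ h = Σ_{v ∈ L} (ρ_m(h) Φ)(v)` — Weil's `Θ(S) = Σ_{ξ ∈ X_k} (SΦ)(ξ)` [We64 n° 41] — jointly
  continuous for `L` discrete (`continuous_thetaH_uncurry`), `Θ_{ρ(h')Φ}(h) = Θ_Φ(h h')` (`thetaH_repCLM`), and
  INVARIANT (`thetaH_arith_mul`) under the arithmetic subgroup `arith V L m = {(a, b, u) : a ∈ L, m b ∈ L*, u^m = 1}`
  (a genuine `Subgroup (Heis V)`: closure is `𝐞(-⟪a, b'⟫)^m = 1` for `a ∈ L`, `m b' ∈ L*`,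
  `fourierChar_cocycle_zpow_eq_one`) — BOTH halves, translations by `L` AND modulations by `L*/m`; the modulation
  half is the duality `𝐞(⟪w, v⟫) = 1` of #1/#4 (`fourierChar_inner_eq_one_of_mem_dualLattice`);
* `heisenbergModel V L m Γ hΓ : HodgeCM.WeilThetaModel (Heis V) (arith V L m) Circle Γ` — every field of prl1-g4's
  record a theorem / construction (`W := datumH V L m`, `s := Heis.splitting`, `(h, z) ↦ h · c(z)` with `c` the
  centre, `SK := univ`); `heisenbergModel_θ_mk_eq` computes the descended kernel, `heisenbergModel_θ_ne_zero`,
  `heisenbergModel_structural_laws`; and `Heis.ofSchrodinger : Multiplicative V × Circle →* Heis V` exhibits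
  pv14-g4's model as the `b = 0` restriction (`repCLM_ofSchrodinger`, `thetaH_ofSchrodinger`, `ofSchrodinger_mem_arith`).

No full-rank hypothesis on `L` is used anywhere (only `DiscreteTopology L`, for summability / continuity).

LABELS.  KERNEL throughout (Mathlib + pv14-g4 #1/#2 + this seat's #1/#4).  NOT CLAIMED (GAPS pv14g4-K1 (b), (c-fin)):
the Weyl element / metaplectic cocycle on `Sp(V ⊕ V)` beyond the Heisenberg group (theta-level shadow: this seat's
#3 `theta_dualLattice_fourier`), finite places, the adelic product.  No PerL / QW8 / 2001 statement is used.
-/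

set_option autoImplicit false

noncomputable section

open MeasureTheory
open scoped RealInnerProductSpace FourierTransform SchwartzMap

namespace HodgeCM
namespace SchwartzWeil

/-! ## 1. The polarised Heisenberg group `Heis V = V × V × U(1)` -/

/-- The polarised Heisenberg group of a real inner product space `V`: triples `(a, b, u)` — a translation `a ∈ X`,
a modulation `b ∈ X*` (identified with `X` by the inner product) and a phase `u ∈ U(1)`. -/
@[ext]
structure Heis (V : Type*) [NormedAddCommGroup V] [InnerProductSpace ℝ V] where
  /-- translation part -/
  a : V
  /-- modulation part -/
  b : V
  /-- central phase -/
  u : Circle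

namespace Heis

variable {V : Type*} [NormedAddCommGroup V] [InnerProductSpace ℝ V]

/-- (Ported verbatim from the HodgeCMPerL package; no docstring in the source.) -/
instance : Mul (Heis V) := ⟨fun h h' => ⟨h.a + h'.a, h.b + h'.b, h.u * h'.u * 𝐞 (-⟪h.a, h'.b⟫)⟩⟩
/-- (Ported verbatim from the HodgeCMPerL package; no docstring in the source.) -/
instance : One (Heis V) := ⟨⟨0, 0, 1⟩⟩
/-- (Ported verbatim from the HodgeCMPerL package; no docstring in the source.) -/
instance : Inv (Heis V) := ⟨fun h => ⟨-h.a, -h.b, h.u⁻¹ * 𝐞 (-⟪h.a, h.b⟫)⟩⟩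

/-- (Ported verbatim from the HodgeCMPerL package; no docstring in the source.) -/
@[simp] theorem mul_a (h h' : Heis V) : (h * h').a = h.a + h'.a := rfl
/-- (Ported verbatim from the HodgeCMPerL package; no docstring in the source.) -/
@[simp] theorem mul_b (h h' : Heis V) : (h * h').b = h.b + h'.b := rfl
/-- (Ported verbatim from the HodgeCMPerL package; no docstring in the source.) -/
@[simp] theorem mul_u (h h' : Heis V) : (h * h').u = h.u * h'.u * 𝐞 (-⟪h.a, h'.b⟫) := rfl
/-- (Ported verbatim from the HodgeCMPerL package; no docstring in the source.) -/
@[simp] theorem one_a : (1 : Heis V).a = 0 := rfl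
/-- (Ported verbatim from the HodgeCMPerL package; no docstring in the source.) -/
@[simp] theorem one_b : (1 : Heis V).b = 0 := rfl
/-- (Ported verbatim from the HodgeCMPerL package; no docstring in the source.) -/
@[simp] theorem one_u : (1 : Heis V).u = 1 := rfl
/-- (Ported verbatim from the HodgeCMPerL package; no docstring in the source.) -/
@[simp] theorem inv_a (h : Heis V) : h⁻¹.a = -h.a := rfl
/-- (Ported verbatim from the HodgeCMPerL package; no docstring in the source.) -/
@[simp] theorem inv_b (h : Heis V) : h⁻¹.b = -h.b := rfl
/-- (Ported verbatim from the HodgeCMPerL package; no docstring in the source.) -/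
@[simp] theorem inv_u (h : Heis V) : h⁻¹.u = h.u⁻¹ * 𝐞 (-⟪h.a, h.b⟫) := rfl

/-- **`Heis V` is a group** (the cocycle `𝐞(-⟪a, b'⟫)` is bilinear, hence a 2-cocycle). -/
instance : Group (Heis V) :=
  Group.ofLeftAxioms
    (fun h h' h'' => by
      ext
      · simp only [mul_a, add_assoc]
      · simp only [mul_b, add_assoc]
      · simp only [mul_u, mul_a, mul_b, inner_add_left, inner_add_right, neg_add, AddChar.map_add_eq_mul,
          Circle.coe_mul]
        ring)
    (fun h => by
      ext
      · simp only [mul_a, one_a, zero_add]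
      · simp only [mul_b, one_b, zero_add]
      · simp only [mul_u, one_u, one_a, inner_zero_left, neg_zero, AddChar.map_zero_eq_one, one_mul, mul_one])
    (fun h => by
      ext
      · simp only [mul_a, inv_a, neg_add_cancel, one_a]
      · simp only [mul_b, inv_b, neg_add_cancel, one_b]
      · simp only [mul_u, inv_u, inv_a, one_u, inner_neg_left, neg_neg, AddChar.map_neg_eq_inv, Circle.coe_mul,
          Circle.coe_inv, Circle.coe_one]
        field_simp)

/-- The centre: `c(z) = (0, 0, z)`. -/
def center : Circle →* Heis V where
  toFun z := ⟨0, 0, z⟩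
  map_one' := rfl
  map_mul' z w := by
    ext
    · simp only [mul_a, add_zero]
    · simp only [mul_b, add_zero]
    · simp only [mul_u, inner_zero_left, neg_zero, AddChar.map_zero_eq_one, mul_one]

/-- (Ported verbatim from the HodgeCMPerL package; no docstring in the source.) -/
@[simp] theorem center_a (z : Circle) : (center z : Heis V).a = 0 := rfl
/-- (Ported verbatim from the HodgeCMPerL package; no docstring in the source.) -/
@[simp] theorem center_b (z : Circle) : (center z : Heis V).b = 0 := rfl
/-- (Ported verbatim from the HodgeCMPerL package; no docstring in the source.) -/
@[simp] theorem center_u (z : Circle) : (center z : Heis V).u = z := rfl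

/-- (Ported verbatim from the HodgeCMPerL package; no docstring in the source.) -/
theorem center_mul_comm (z : Circle) (h : Heis V) : center z * h = h * center z := by
  ext
  · simp only [mul_a, center_a, zero_add, add_zero]
  · simp only [mul_b, center_b, zero_add, add_zero]
  · simp only [mul_u, center_u, center_a, center_b, inner_zero_left, inner_zero_right, neg_zero,
      AddChar.map_zero_eq_one, mul_one, mul_comm]

/-- pv14-g4's commutative group `Multiplicative V × U(1)` (translations and phases) sits inside `Heis V` as `b = 0`. -/
def ofSchrodinger : Multiplicative V × Circle →* Heis V where
  toFun S := ⟨Multiplicative.toAdd S.1, 0, S.2⟩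
  map_one' := rfl
  map_mul' S S' := by
    ext
    · simp only [toAdd_mul, Prod.fst_mul, mul_a]
    · simp only [mul_b, add_zero]
    · simp only [Prod.snd_mul, mul_u, inner_zero_right, neg_zero, AddChar.map_zero_eq_one, mul_one]

/-- (Ported verbatim from the HodgeCMPerL package; no docstring in the source.) -/
@[simp] theorem ofSchrodinger_a (S : Multiplicative V × Circle) :
    (ofSchrodinger S : Heis V).a = Multiplicative.toAdd S.1 := rfl
/-- (Ported verbatim from the HodgeCMPerL package; no docstring in the source.) -/
@[simp] theorem ofSchrodinger_b (S : Multiplicative V × Circle) : (ofSchrodinger S : Heis V).b = 0 := rfl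
/-- (Ported verbatim from the HodgeCMPerL package; no docstring in the source.) -/
@[simp] theorem ofSchrodinger_u (S : Multiplicative V × Circle) : (ofSchrodinger S : Heis V).u = S.2 := rfl

/-! ### Topology: the product topology of `V × V × U(1)` -/

/-- The underlying triple. -/
def toProd (h : Heis V) : V × V × Circle := (h.a, h.b, h.u)

/-- (Ported verbatim from the HodgeCMPerL package; no docstring in the source.) -/
theorem toProd_injective : Function.Injective (toProd : Heis V → V × V × Circle) := by
  intro h h' e
  simp only [toProd, Prod.mk.injEq] at e
  exact Heis.ext e.1 e.2.1 e.2.2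

/-- (Ported verbatim from the HodgeCMPerL package; no docstring in the source.) -/
instance : TopologicalSpace (Heis V) := TopologicalSpace.induced toProd inferInstance

/-- (Ported verbatim from the HodgeCMPerL package; no docstring in the source.) -/
theorem continuous_toProd : Continuous (toProd : Heis V → V × V × Circle) := continuous_induced_dom

/-- (Ported verbatim from the HodgeCMPerL package; no docstring in the source.) -/
theorem continuous_a : Continuous fun h : Heis V => h.a := continuous_fst.comp continuous_toProd
/-- (Ported verbatim from the HodgeCMPerL package; no docstring in the source.) -/
theorem continuous_b : Continuous fun h : Heis V => h.b := (continuous_fst.comp continuous_snd).comp continuous_toProd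
/-- (Ported verbatim from the HodgeCMPerL package; no docstring in the source.) -/
theorem continuous_u : Continuous fun h : Heis V => h.u := (continuous_snd.comp continuous_snd).comp continuous_toProd

/-- A map into `Heis V` is continuous iff its three components are. -/
theorem continuous_mk {X : Type*} [TopologicalSpace X] {fa fb : X → V} {fu : X → Circle} (ha : Continuous fa)
    (hb : Continuous fb) (hu : Continuous fu) : Continuous fun x => (⟨fa x, fb x, fu x⟩ : Heis V) :=
  continuous_induced_rng.2 (ha.prodMk (hb.prodMk hu))

/-- **`Heis V` is a topological group.** -/
instance : IsTopologicalGroup (Heis V) where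
  continuous_mul := by
    have ha := continuous_a (V := V)
    have hb := continuous_b (V := V)
    have hu := continuous_u (V := V)
    refine continuous_mk ((ha.comp continuous_fst).add (ha.comp continuous_snd))
      ((hb.comp continuous_fst).add (hb.comp continuous_snd)) ?_
    exact ((hu.comp continuous_fst).mul (hu.comp continuous_snd)).mul
      (Real.continuous_fourierChar.comp (((ha.comp continuous_fst).inner (hb.comp continuous_snd)).neg))
  continuous_inv := by
    refine continuous_mk continuous_a.neg continuous_b.neg ?_
    exact continuous_u.inv.mul (Real.continuous_fourierChar.comp ((continuous_a.inner continuous_b).neg))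

/-- (Ported verbatim from the HodgeCMPerL package; no docstring in the source.) -/
theorem continuous_center : Continuous (center : Circle → Heis V) :=
  continuous_mk continuous_const continuous_const continuous_id

/-- (Ported verbatim from the HodgeCMPerL package; no docstring in the source.) -/
theorem continuous_ofSchrodinger : Continuous (ofSchrodinger : Multiplicative V × Circle → Heis V) :=
  continuous_mk (continuous_toAdd.comp continuous_fst) continuous_const continuous_snd

/-- The splitting `s : Heis V × U(1) → Heis V`, `(h, z) ↦ h · c(z)` (a homomorphism because `c` is central). -/
def splitting : Heis V × Circle →* Heis V :=
  MonoidHom.mk' (fun p => p.1 * center p.2) (by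
    intro p q
    ext
    · simp only [Prod.fst_mul, mul_a, center_a, add_zero]
    · simp only [Prod.fst_mul, mul_b, center_b, add_zero]
    · simp only [Prod.fst_mul, Prod.snd_mul, mul_u, mul_a, mul_b, center_a, center_b, center_u, inner_zero_right,
        add_zero, neg_zero, AddChar.map_zero_eq_one, mul_one, Circle.coe_mul]
      ring)

/-- (Ported verbatim from the HodgeCMPerL package; no docstring in the source.) -/
@[simp] theorem splitting_apply (p : Heis V × Circle) : splitting p = p.1 * center p.2 := rfl

/-- (Ported verbatim from the HodgeCMPerL package; no docstring in the source.) -/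
theorem continuous_splitting : Continuous (splitting : Heis V × Circle → Heis V) :=
  continuous_fst.mul (continuous_center.comp continuous_snd)

end Heis

/-! ## 2. The weight-`m` Schrödinger representation of `Heis V` on `𝓢(V, ℂ)` -/

section Rep

variable (V : Type) [NormedAddCommGroup V] [InnerProductSpace ℝ V] [FiniteDimensional ℝ V] [MeasurableSpace V]
  [BorelSpace V] (m : ℤ)

/-- **The weight-`m` Schrödinger representation** `ρ_m(a, b, u) = u^m • M_{m b} ∘ τ_a` of the Heisenberg group on
Schwartz space, by continuous `ℂ`-linear operators. -/
def repCLM (h : Heis V) : 𝓢(V, ℂ) →L[ℂ] 𝓢(V, ℂ) :=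
  ((h.u ^ m : Circle) : ℂ) • ((modCLM V ((m : ℝ) • h.b)).comp (SchwartzMap.compSubConstCLM ℂ h.a))

/-- (Ported verbatim from the HodgeCMPerL package; no docstring in the source.) -/
@[simp]
theorem repCLM_apply (h : Heis V) (Φ : 𝓢(V, ℂ)) (x : V) :
    repCLM V m h Φ x = (h.u : ℂ) ^ m * ((𝐞 ⟪(m : ℝ) • h.b, x⟫ : ℂ) * Φ (x - h.a)) := by
  simp only [repCLM, ContinuousLinearMap.comp_apply, smul_apply, smul_eq_mul, modCLM_apply,
    SchwartzMap.compSubConstCLM_apply, Circle.coe_zpow]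

/-- (Ported verbatim from the HodgeCMPerL package; no docstring in the source.) -/
theorem repCLM_one_apply (Φ : 𝓢(V, ℂ)) : repCLM V m 1 Φ = Φ := by
  ext x
  simp only [repCLM_apply, Heis.one_u, Heis.one_a, Heis.one_b, Circle.coe_one, one_zpow, smul_zero,
    inner_zero_left, AddChar.map_zero_eq_one, sub_zero, one_mul]

/-- (Ported verbatim from the HodgeCMPerL package; no docstring in the source.) -/
theorem repCLM_one : repCLM V m 1 = ContinuousLinearMap.id ℂ 𝓢(V, ℂ) := by
  ext Φ x
  rw [repCLM_one_apply, ContinuousLinearMap.id_apply]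

omit [FiniteDimensional ℝ V] [MeasurableSpace V] [BorelSpace V] in
/-- The phase bookkeeping behind the homomorphism law: `𝐞(-⟪a, b'⟫)^m 𝐞(m⟪b + b', x⟫) = 𝐞(m⟪b, x⟫) 𝐞(m⟪b', x - a⟫)`. -/
theorem repCLM_phase (a b b' x : V) :
    ((𝐞 (-⟪a, b'⟫) : Circle) : ℂ) ^ m * (𝐞 ⟪(m : ℝ) • (b + b'), x⟫ : ℂ) =
      (𝐞 ⟪(m : ℝ) • b, x⟫ : ℂ) * (𝐞 ⟪(m : ℝ) • b', x - a⟫ : ℂ) := by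
  have harg : m • -⟪a, b'⟫ + ⟪(m : ℝ) • (b + b'), x⟫ = ⟪(m : ℝ) • b, x⟫ + ⟪(m : ℝ) • b', x - a⟫ := by
    simp only [real_inner_smul_left, inner_add_left, inner_sub_right, zsmul_eq_mul, real_inner_comm a b']
    ring
  rw [← Circle.coe_zpow, ← AddChar.map_zsmul_eq_zpow, ← Circle.coe_mul, ← Circle.coe_mul,
    ← AddChar.map_add_eq_mul, ← AddChar.map_add_eq_mul, harg]

/-- **Homomorphism law** `ρ_m(h h') = ρ_m(h) ∘ ρ_m(h')` — the Heisenberg commutation relation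
`τ_a M_b = 𝐞(-⟪b, a⟫) M_b τ_a` (`SchwartzModulation.compSubConstCLM_comp_modCLM`) in group form. -/
theorem repCLM_mul (h h' : Heis V) : repCLM V m (h * h') = (repCLM V m h).comp (repCLM V m h') := by
  ext Φ x
  simp only [ContinuousLinearMap.comp_apply, repCLM_apply, Heis.mul_a, Heis.mul_b, Heis.mul_u, Circle.coe_mul,
    mul_zpow]
  rw [sub_sub]
  linear_combination ((h.u : ℂ) ^ m * (h'.u : ℂ) ^ m * Φ (x - (h.a + h'.a))) * repCLM_phase V m h.a h.b h'.b x

/-- (Ported verbatim from the HodgeCMPerL package; no docstring in the source.) -/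
theorem repCLM_mul_apply (h h' : Heis V) (Φ : 𝓢(V, ℂ)) :
    repCLM V m (h * h') Φ = repCLM V m h (repCLM V m h' Φ) := by
  rw [repCLM_mul, ContinuousLinearMap.comp_apply]

/-- The representation as a monoid homomorphism into the operator algebra. -/
def rep : Heis V →* (𝓢(V, ℂ) →L[ℂ] 𝓢(V, ℂ)) where
  toFun := repCLM V m
  map_one' := repCLM_one V m
  map_mul' := repCLM_mul V m

/-- (Ported verbatim from the HodgeCMPerL package; no docstring in the source.) -/
@[simp] theorem rep_apply (h : Heis V) : rep V m h = repCLM V m h := rfl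

/-- `sup |ρ_m(h) Φ| = sup |Φ|`: the representation is isometric for the sup norm. -/
theorem norm_repCLM_apply (h : Heis V) (Φ : 𝓢(V, ℂ)) (x : V) : ‖repCLM V m h Φ x‖ = ‖Φ (x - h.a)‖ := by
  rw [repCLM_apply, norm_mul, norm_mul, norm_zpow, Circle.norm_coe, one_zpow, one_mul, Circle.norm_coe, one_mul]

/-- On `b = 0` the representation is pv14-g4's action `act` (translations and phases). -/
theorem repCLM_ofSchrodinger (S : Multiplicative V × Circle) (Φ : 𝓢(V, ℂ)) :
    repCLM V m (Heis.ofSchrodinger S) Φ = act V m S Φ := by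
  ext x
  rw [repCLM_apply, act_apply]
  simp only [Heis.ofSchrodinger_u, Heis.ofSchrodinger_b, Heis.ofSchrodinger_a, smul_zero, inner_zero_left,
    AddChar.map_zero_eq_one, Circle.coe_one, one_mul]

/-- The centre acts by the character `z ↦ z^m`. -/
theorem repCLM_center (z : Circle) (Φ : 𝓢(V, ℂ)) : repCLM V m (Heis.center z) Φ = ((z ^ m : Circle) : ℂ) • Φ := by
  ext x
  simp only [repCLM_apply, Heis.center_u, Heis.center_b, Heis.center_a, smul_zero, inner_zero_left,
    AddChar.map_zero_eq_one, Circle.coe_one, one_mul, sub_zero, smul_apply, smul_eq_mul, Circle.coe_zpow]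

/-- **Joint continuity of the Schrödinger representation of the Heisenberg group** `(h, Φ) ↦ ρ_m(h) Φ` on
`Heis V × 𝓢(V, ℂ)` — translations (pv14-g4 `continuous_compSubConstCLM_uncurry`), modulations
(`continuous_modCLM_uncurry`, #4) and phases. -/
theorem continuous_repCLM_uncurry : Continuous (Function.uncurry fun h (Φ : 𝓢(V, ℂ)) => repCLM V m h Φ) := by
  have hτ : Continuous fun p : Heis V × 𝓢(V, ℂ) => SchwartzMap.compSubConstCLM ℂ p.1.a p.2 := by
    have h := (continuous_compSubConstCLM_uncurry ℂ (E := V) (F := ℂ)).comp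
      ((Heis.continuous_a.comp continuous_fst).prodMk (continuous_snd (X := Heis V) (Y := 𝓢(V, ℂ))))
    dsimp only [Function.comp_def] at h
    exact h
  have hM := (continuous_modCLM_uncurry V).comp
    (((Heis.continuous_b.comp continuous_fst).const_smul (m : ℝ)).prodMk hτ)
  dsimp only [Function.comp_def] at hM
  have hc : Continuous fun p : Heis V × 𝓢(V, ℂ) => ((p.1.u ^ m : Circle) : ℂ) :=
    continuous_subtype_val.comp ((continuous_zpow (G := Circle) m).comp (Heis.continuous_u.comp continuous_fst))
  have h := hc.smul hM
  simp only [Function.uncurry_def, repCLM, smul_apply, ContinuousLinearMap.comp_apply]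
  exact h

/-- (Ported verbatim from the HodgeCMPerL package; no docstring in the source.) -/
theorem continuous_repCLM_left (Φ : 𝓢(V, ℂ)) : Continuous fun h : Heis V => repCLM V m h Φ := by
  have h := (continuous_repCLM_uncurry V m).comp
    ((continuous_id (X := Heis V)).prodMk (continuous_const (y := Φ)))
  simp only [Function.comp_def, Function.uncurry_def, id] at h
  exact h

end Rep

/-! ## 3. The theta function on the Heisenberg group and its arithmetic invariance -/

section Theta

variable (V : Type) [NormedAddCommGroup V] [InnerProductSpace ℝ V] [FiniteDimensional ℝ V] [MeasurableSpace V]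
  [BorelSpace V] (L : Submodule ℤ V) (m : ℤ)

/-- **Weil's theta function on the Heisenberg group** [We64 n° 41]: `Θ_Φ(h) = Σ_{v ∈ L} (ρ_m(h) Φ)(v)`. -/
def thetaH (Φ : 𝓢(V, ℂ)) (h : Heis V) : ℂ := ∑' v : L, repCLM V m h Φ (v : V)

/-- Explicit form: `Θ_Φ(a, b, u) = u^m Σ_{v ∈ L} 𝐞(m⟪b, v⟫) Φ(v - a)`. -/
theorem thetaH_eq (Φ : 𝓢(V, ℂ)) (h : Heis V) :
    thetaH V L m Φ h = (h.u : ℂ) ^ m * ∑' v : L, (𝐞 ⟪(m : ℝ) • h.b, (v : V)⟫ : ℂ) * Φ ((v : V) - h.a) := by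
  simp only [thetaH, repCLM_apply, tsum_mul_left]

/-- `Θ_{ρ(h')Φ}(h) = Θ_Φ(h h')` (the `theta_act` law of the datum). -/
theorem thetaH_repCLM (Φ : 𝓢(V, ℂ)) (h h' : Heis V) :
    thetaH V L m (repCLM V m h' Φ) h = thetaH V L m Φ (h * h') := by
  simp only [thetaH, repCLM_mul_apply]

/-- (Ported verbatim from the HodgeCMPerL package; no docstring in the source.) -/
theorem thetaH_one (Φ : 𝓢(V, ℂ)) : thetaH V L m Φ 1 = ∑' v : L, Φ (v : V) := by
  simp only [thetaH, repCLM_one_apply]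

/-- On `b = 0` it is pv14-g4's theta function. -/
theorem thetaH_ofSchrodinger (Φ : 𝓢(V, ℂ)) (S : Multiplicative V × Circle) :
    thetaH V L m Φ (Heis.ofSchrodinger S) = theta V L m Φ S := by
  simp only [thetaH, repCLM_ofSchrodinger]
  rfl

omit [FiniteDimensional ℝ V] [MeasurableSpace V] [BorelSpace V] in
/-- For `a ∈ L` and `m b' ∈ L*` the Heisenberg cocycle is trivial in weight `m`: `𝐞(-⟪a, b'⟫)^m = 1`. -/
theorem fourierChar_cocycle_zpow_eq_one {a b' : V} (ha : a ∈ L)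
    (hb : (m : ℝ) • b' ∈ PoissonSummation.dualLattice L) : 𝐞 (-⟪a, b'⟫) ^ m = 1 := by
  have h1 : 𝐞 ⟪(m : ℝ) • b', ((⟨a, ha⟩ : L) : V)⟫ = 1 := fourierChar_inner_eq_one_of_mem_dualLattice V L hb ⟨a, ha⟩
  have h2 : m • -⟪a, b'⟫ = -⟪(m : ℝ) • b', a⟫ := by
    rw [zsmul_eq_mul, real_inner_smul_left, real_inner_comm a b']
    ring
  rw [← AddChar.map_zsmul_eq_zpow, h2, AddChar.map_neg_eq_inv, inv_eq_one]
  exact h1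

end Theta

section Arith


-- port_pkg: scope closed for this part
end Arith
end SchwartzWeil
end HodgeCM
end
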